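import Mathlib
import Summits.Ventures.PercRepro.PuncturedLYMQuadSymRows0
import Summits.Ventures.PercRepro.PuncturedLYMQuadSymRows1
import Summits.Ventures.PercRepro.PuncturedLYMQuadSymRows2
import Summits.Ventures.PercRepro.PuncturedLYMQuadSymRows3
import Summits.Ventures.PercRepro.PuncturedLYMQuadSymCols0
import Summits.Ventures.PercRepro.PuncturedLYMQuadSymCols1
import Summits.Ventures.PercRepro.PuncturedLYMQuadSymCols2
import Summits.Ventures.PercRepro.PuncturedLYMQuadSymCols3

/-!
# PercRepro — (SP) FOR FOUR PAIRWISE DISJOINT TRIPLES AT LEVEL 4, `n = m + 17`: THE ROW CHECKS, a₀ = 0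
(p10, gen 39)

The enumerations over the row types (50), the free column types (66) and the member columns of the symbolic certificate
of four triples, reduced to the identities of PuncturedLYMQuadSymRows*/Cols* (split by the first two coordinates) and to
the constant member-column entries `1/3`. Nothing here asserts (SP).
-/

namespace PercRepro.PuncturedLYM.Split.TypeLift.QuadSym

open Finset

/-- The row equations, `(a₀, a₁) = (0, 0)`. -/
theorem row_check_0_0 (m : ℚ) (hm : 0 ≤ m) (a₂ a₃ c : ℕ) (h₂ : a₂ ≤ 2) (h₃ : a₃ ≤ 2)
    (hs : 0 + 0 + a₂ + a₃ + c = 4) :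
    ((3 - 0 : ℕ) : ℚ) * W m ![0, 0, a₂, a₃] c (some 0) + ((3 - 0 : ℕ) : ℚ) * W m ![0, 0, a₂, a₃] c (some 1) +
      ((3 - a₂ : ℕ) : ℚ) * W m ![0, 0, a₂, a₃] c (some 2) + ((3 - a₃ : ℕ) : ℚ) * W m ![0, 0, a₂, a₃] c (some 3) +
      (m + 5 - (c : ℚ)) * W m ![0, 0, a₂, a₃] c none = 1 / P m := by
  have hc : c ≤ 4 := by omega
  interval_cases a₂
  · interval_cases a₃
    · interval_cases c
      · omega
      · omega
      · omega
      · omega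
      · exact rowW_0_0_0_0 m hm
    · interval_cases c
      · omega
      · omega
      · omega
      · exact rowW_0_0_0_1 m hm
      · omega
    · interval_cases c
      · omega
      · omega
      · exact rowW_0_0_0_2 m hm
      · omega
      · omega
  · interval_cases a₃
    · interval_cases c
      · omega
      · omega
      · omega
      · exact rowW_0_0_1_0 m hm
      · omega
    · interval_cases c
      · omega
      · omega
      · exact rowW_0_0_1_1 m hm
      · omega
      · omega
    · interval_cases c
      · omega
      · exact rowW_0_0_1_2 m hm
      · omega
      · omega
      · omega
  · interval_cases a₃
    · interval_cases c
      · omega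
      · omega
      · exact rowW_0_0_2_0 m hm
      · omega
      · omega
    · interval_cases c
      · omega
      · exact rowW_0_0_2_1 m hm
      · omega
      · omega
      · omega
    · interval_cases c
      · exact rowW_0_0_2_2 m hm
      · omega
      · omega
      · omega
      · omega

/-- The row equations, `(a₀, a₁) = (0, 1)`. -/
theorem row_check_0_1 (m : ℚ) (hm : 0 ≤ m) (a₂ a₃ c : ℕ) (h₂ : a₂ ≤ 2) (h₃ : a₃ ≤ 2)
    (hs : 0 + 1 + a₂ + a₃ + c = 4) :
    ((3 - 0 : ℕ) : ℚ) * W m ![0, 1, a₂, a₃] c (some 0) + ((3 - 1 : ℕ) : ℚ) * W m ![0, 1, a₂, a₃] c (some 1) +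
      ((3 - a₂ : ℕ) : ℚ) * W m ![0, 1, a₂, a₃] c (some 2) + ((3 - a₃ : ℕ) : ℚ) * W m ![0, 1, a₂, a₃] c (some 3) +
      (m + 5 - (c : ℚ)) * W m ![0, 1, a₂, a₃] c none = 1 / P m := by
  have hc : c ≤ 4 := by omega
  interval_cases a₂
  · interval_cases a₃
    · interval_cases c
      · omega
      · omega
      · omega
      · exact rowW_0_1_0_0 m hm
      · omega
    · interval_cases c
      · omega
      · omega
      · exact rowW_0_1_0_1 m hm
      · omega
      · omega
    · interval_cases c
      · omega
      · exact rowW_0_1_0_2 m hm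
      · omega
      · omega
      · omega
  · interval_cases a₃
    · interval_cases c
      · omega
      · omega
      · exact rowW_0_1_1_0 m hm
      · omega
      · omega
    · interval_cases c
      · omega
      · exact rowW_0_1_1_1 m hm
      · omega
      · omega
      · omega
    · interval_cases c
      · exact rowW_0_1_1_2 m hm
      · omega
      · omega
      · omega
      · omega
  · interval_cases a₃
    · interval_cases c
      · omega
      · exact rowW_0_1_2_0 m hm
      · omega
      · omega
      · omega
    · interval_cases c
      · exact rowW_0_1_2_1 m hm
      · omega
      · omega
      · omega
      · omega
    · interval_cases c
      · omega
      · omega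
      · omega
      · omega
      · omega

/-- The row equations, `(a₀, a₁) = (0, 2)`. -/
theorem row_check_0_2 (m : ℚ) (hm : 0 ≤ m) (a₂ a₃ c : ℕ) (h₂ : a₂ ≤ 2) (h₃ : a₃ ≤ 2)
    (hs : 0 + 2 + a₂ + a₃ + c = 4) :
    ((3 - 0 : ℕ) : ℚ) * W m ![0, 2, a₂, a₃] c (some 0) + ((3 - 2 : ℕ) : ℚ) * W m ![0, 2, a₂, a₃] c (some 1) +
      ((3 - a₂ : ℕ) : ℚ) * W m ![0, 2, a₂, a₃] c (some 2) + ((3 - a₃ : ℕ) : ℚ) * W m ![0, 2, a₂, a₃] c (some 3) +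
      (m + 5 - (c : ℚ)) * W m ![0, 2, a₂, a₃] c none = 1 / P m := by
  have hc : c ≤ 4 := by omega
  interval_cases a₂
  · interval_cases a₃
    · interval_cases c
      · omega
      · omega
      · exact rowW_0_2_0_0 m hm
      · omega
      · omega
    · interval_cases c
      · omega
      · exact rowW_0_2_0_1 m hm
      · omega
      · omega
      · omega
    · interval_cases c
      · exact rowW_0_2_0_2 m hm
      · omega
      · omega
      · omega
      · omega
  · interval_cases a₃
    · interval_cases c
      · omega
      · exact rowW_0_2_1_0 m hm
      · omega
      · omega
      · omega
    · interval_cases c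
      · exact rowW_0_2_1_1 m hm
      · omega
      · omega
      · omega
      · omega
    · interval_cases c
      · omega
      · omega
      · omega
      · omega
      · omega
  · interval_cases a₃
    · interval_cases c
      · exact rowW_0_2_2_0 m hm
      · omega
      · omega
      · omega
      · omega
    · interval_cases c
      · omega
      · omega
      · omega
      · omega
      · omega
    · interval_cases c
      · omega
      · omega
      · omega
      · omega
      · omega

end PercRepro.PuncturedLYM.Split.TypeLift.QuadSym
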